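import Literature.IUT.HodgeArakelov.KummerStructures
import Literature.AnabelianGeometry.SemiGraphs.CosetCategories
import Literature.AlgebraicGeometry.Frobenioids.ModelFrobenioid
import Literature.AlgebraicGeometry.Frobenioids.ElementaryFrobenioid
import HarnessLib

/-!
# [IUTchII] Definition 3.8 (i)(ii) / Remark 3.8.1: the model Frobenioid of a `G`-monoid over the small base
# `CosetCat G` — "each of the monoids equipped with a [Galois] action … gives rise to a `p_v`-adic Frobenioid"

S. Mochizuki, *Inter-universal Teichmüller theory II*, §3, kurims Dec-2020 manuscript, Definition 3.8 (i) p. 113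
l. 1–14 and (ii) p. 113 l. 40–52: «Each of the monoids equipped with a `Π_X(M^Θ_*)`-action … [resp. with a
topological group action `G_v(M^Θ_*▶) ↷ Ψ^ι_env(M^Θ_*)`; … `↷ Ψ_{†F^Θ_v,α}`; … `↷ Ψ_ξ(M^Θ_*)`; … `↷ Ψ_{F_ξ}(†F_v)`]
gives rise to a `p_v`-adic Frobenioid of monoid type `ℤ` [cf. [FrdII], Example 1.1, (ii)] … whose divisor monoid
associates to every object of `B^temp(Π_X(M^Θ_*))⁰` [resp. `B^temp(G_v(−))⁰`] a monoid isomorphic to `ℚ≥0`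
[resp. `ℕ`]» [cite: Mochizuki2012, Def 3.8 (i)(ii) p.113], read at the MONOID level as Remark 3.8.1 (p. 115)
advises («the simplest approach is to resort to the original monoid-theoretic formulations»).

abc-iut cell, layer L6, residual **R-Def38-a** of NODES `IUTchII:Def3.8(i)(ii)(iii)` (MERGE-MAP §1 l.122 / §8S;
L6-lead gen 4 GO «DEF38-FRD-BRIDGE» 13:57:45Z). CONSTRUCTION DATA ONLY (no `Prop`-valued fact, no instance, no
notation; claim key DISPUTED, D-0012 — nothing of [IUTchII] is asserted): for a `G`-monoid
`M : KummerStructures.CoveringMonoid G` ([IUTchII] Def 4.9 (i) «`G ↷ O^▷(A)`», abc-iut-L6-t2) over a topological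
group `G`, on abc-iut-L5-t2's SMALL base `CosetCat G` (the connected objects `G/U`, `U` open, of `B^temp(G)`,
[FrdII] Ex 1.3 (i); connected and totally epimorphic there):
* `invariants U = Ψ^U ⊆ O` — the monoid attached to the connected object `G/U`;
* `invariantsFunctor : (CosetCat G)ᵒᵖ ⥤ CommMonCat` — `G/U ↦ Ψ^U`, pull-back along `G/U → G/V` (`1·U ↦ a·V`,
  so `a⁻¹Ua ≤ V`) = the action of the representative `a` (independent of the representative on `Ψ^V`);
* `divisorFunctor := charFunctor invariantsFunctor` — the DIVISOR MONOID `Φ(G/U) := Ψ^U/(Ψ^U)^×` ([FrdI] §0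
  `M^char`, abc-iut-L1's `charFunctor` BY NAME); `ratFnFunctor := monoidGp invariantsFunctor` — `B(G/U) := (Ψ^U)^gp`;
  `divB : B ⟶ Φ^gp` — the class map, groupified (`toCharNatTrans` whiskered with abc-iut-L1's `MonGp.functor`);
* `frobenioid M := ModelFrobenioid divisorFunctor ratFnFunctor divB` — abc-iut-L1-t2's [FrdI] Thm 5.2 (i) category
  BY NAME: the Frobenioid print attaches to `G ↷ Ψ`;
* `ofStable ρ S hS` — the `G`-monoid obtained by restricting an action `ρ : G →* MulAut H` to a `ρ`-stable submonoid
  `S ⊆ H` (how the §3 monoids `Ψ^ι_env = M^×_TM·θ^ℕ ⊆ lim H¹(…)`, `Ψ_{†F^Θ_v,α}`, `Ψ_ξ`, `Ψ_{F_ξ}`, `Ψ_cns` of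
  abc-iut-L6-t2's `TemperedThetaMonoids` become `CoveringMonoid`s).
That `frobenioid M` satisfies the hypotheses of [FrdI] Thm 5.2 (`ModelFrobenioid.Hypotheses`) and that its divisor
monoid is `≅ ℕ` at EVERY object for the split theta / Gaussian monoids are PROVED in the proof-only companion
`GMonoidFrobenioidsDef38Proofs.lean`; the «`≅ ℚ≥0`» perfected divisor monoid of `F_cns` at the genuine producers is
abc-iut-L1's `PadicFrd.Datum.perf` over `GaloisValDatum.fieldFunctor` (named follow-up). Nothing of [FrdI]/[FrdII] is
re-typed; no side is taken on [IUTchIII] Cor 3.12; typed ≠ proved.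
-/

noncomputable section

namespace Literature.IUT.HodgeArakelov

namespace CoveringMonoid

open CategoryTheory Opposite Literature.AnabelianGeometry.SemiGraphs Literature.AlgebraicGeometry.Frobenioids

universe u v u₁ v₁ w

variable {G : Type u} [Group G] (M : CoveringMonoid.{u, v} G)

/-! ### The monoid of invariants `Ψ^U` -/

/-- `Ψ^U ⊆ O^▷(A)`: the submonoid of elements fixed by a subgroup `U ≤ G` — the monoid print attaches to the
connected object `G/U` of the base ([IUTchII] Def 3.8 (i)(ii), «associates to every object of `B^temp(G)⁰` a
monoid»). [cite: Mochizuki2012, Def 3.8 (i) p.113] -/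
def invariants (U : Subgroup G) : Submonoid M.O where
  carrier := {x | ∀ u ∈ U, M.act u x = x}
  one_mem' := fun u _ => map_one (M.act u)
  mul_mem' := fun {_ _} hx hy u hu => by rw [map_mul, hx u hu, hy u hu]

/-- Membership in `Ψ^U`. [cite: Mochizuki2012, Def 3.8 (i) p.113] -/
theorem mem_invariants_iff {U : Subgroup G} {x : M.O} : x ∈ M.invariants U ↔ ∀ u ∈ U, M.act u x = x :=
  Iff.rfl

/-- `U ≤ V ⇒ Ψ^V ⊆ Ψ^U`. [cite: Mochizuki2012, Def 3.8 (i) p.113] -/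
theorem invariants_anti {U V : Subgroup G} (h : U ≤ V) : M.invariants V ≤ M.invariants U :=
  fun _ hx u hu => hx u (h hu)

/-- The action of `a ∈ G` carries `Ψ^V` into `Ψ^U` whenever `a⁻¹ U a ≤ V` (the condition under which `1·U ↦ a·V`
is a morphism `G/U → G/V` of the base). [cite: Mochizuki2012, Def 3.8 (i) p.113] -/
theorem act_mem_invariants {U V : Subgroup G} {a : G} (h : ∀ u ∈ U, a⁻¹ * u * a ∈ V) {x : M.O}
    (hx : x ∈ M.invariants V) : M.act a x ∈ M.invariants U := by
  intro u hu
  have h1 : M.act u (M.act a x) = M.act (u * a) x := by rw [← MulAut.mul_apply, ← map_mul]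
  have h3 : a * (a⁻¹ * u * a) = u * a := by group
  have h2 : M.act a (M.act (a⁻¹ * u * a) x) = M.act (u * a) x := by
    rw [← MulAut.mul_apply, ← map_mul, h3]
  rw [h1, ← h2, hx _ (h u hu)]

/-- On `Ψ^V` the action of `a` depends only on the coset `a·V`. [cite: Mochizuki2012, Def 3.8 (i) p.113] -/
theorem act_eq_act_of_mem {V : Subgroup G} {a b : G} (hab : a⁻¹ * b ∈ V) {x : M.O} (hx : x ∈ M.invariants V) :
    M.act a x = M.act b x := by
  have h : M.act b x = M.act a (M.act (a⁻¹ * b) x) := by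
    rw [← MulAut.mul_apply, ← map_mul, mul_inv_cancel_left]
  rw [h, hx _ hab]

variable [TopologicalSpace G]

/-! ### Pull-back along a morphism `G/U → G/V` of the base -/

/-- A representative `a ∈ G` of the point `pt f = a·V ∈ G/V` of a morphism `f : G/U → G/V`.
[cite: MochizukiFrdII2008, Ex 1.3 (i) p.11] -/
def rep {X Y : CosetCat G} (f : X ⟶ Y) : G := Classical.choose (Quotient.exists_rep (CosetCat.pt f))

/-- `rep f` represents `pt f`. [cite: MochizukiFrdII2008, Ex 1.3 (i) p.11] -/
theorem rep_spec {X Y : CosetCat G} (f : X ⟶ Y) : ((rep f : G) : Y.carrier) = CosetCat.pt f :=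
  Classical.choose_spec (Quotient.exists_rep (CosetCat.pt f))

/-- If `a·V = pt f` for `f : G/U → G/V` then `a⁻¹ U a ≤ V` (the point is `U`-fixed). [cite: MochizukiFrdII2008, Ex 1.3 (i) p.11] -/
theorem conj_mem_of_coe_eq_pt {X Y : CosetCat G} (f : X ⟶ Y) {a : G} (ha : ((a : G) : Y.carrier) = CosetCat.pt f) :
    ∀ u ∈ X.sg, a⁻¹ * u * a ∈ (Y.sg : Subgroup G) := by
  intro u hu
  have h := CosetCat.smul_pt f (inv_mem hu)
  rw [← ha, MulAction.Quotient.smul_coe, QuotientGroup.eq] at h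
  -- h : (u⁻¹ * a)⁻¹ * a ∈ Y.sg, i.e. a⁻¹ * u * a ∈ Y.sg
  simpa [mul_assoc] using h

/-- **The pull-back `Ψ^V → Ψ^U` along `f : G/U → G/V`** (`1·U ↦ a·V`): the action of the representative `a`.
[cite: Mochizuki2012, Def 3.8 (i) p.113] -/
def pull {X Y : CosetCat G} (f : X ⟶ Y) : M.invariants (Y.sg : Subgroup G) →* M.invariants (X.sg : Subgroup G) where
  toFun x := ⟨M.act (rep f) x.1, M.act_mem_invariants (conj_mem_of_coe_eq_pt f (rep_spec f)) x.2⟩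
  map_one' := Subtype.ext (map_one _)
  map_mul' _ _ := Subtype.ext (map_mul _ _ _)

/-- The pull-back is the action of ANY representative of `pt f`. [cite: Mochizuki2012, Def 3.8 (i) p.113] -/
theorem coe_pull_eq_act {X Y : CosetCat G} (f : X ⟶ Y) {a : G} (ha : ((a : G) : Y.carrier) = CosetCat.pt f)
    (x : M.invariants (Y.sg : Subgroup G)) : (M.pull f x : M.O) = M.act a x.1 := by
  change M.act (rep f) x.1 = M.act a x.1
  refine M.act_eq_act_of_mem ?_ x.2
  rw [← QuotientGroup.eq, rep_spec f, ha]

/-- Pull-back along the identity is the identity. [cite: Mochizuki2012, Def 3.8 (i) p.113] -/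
theorem pull_id (X : CosetCat G) (x : M.invariants (X.sg : Subgroup G)) : M.pull (𝟙 X) x = x := by
  apply Subtype.ext
  rw [M.coe_pull_eq_act (𝟙 X) (a := 1) (by rw [CosetCat.pt_id]), map_one, MulAut.one_apply]

/-- Pull-back along a composite `G/U → G/V → G/W` is the composite of the pull-backs (contravariantly).
[cite: Mochizuki2012, Def 3.8 (i) p.113] -/
theorem pull_comp {X Y Z : CosetCat G} (f : X ⟶ Y) (g : Y ⟶ Z) (x : M.invariants (Z.sg : Subgroup G)) :
    M.pull (f ≫ g) x = M.pull f (M.pull g x) := by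
  apply Subtype.ext
  have hpt : (((rep f * rep g : G)) : Z.carrier) = CosetCat.pt (f ≫ g) := by
    rw [CosetCat.pt_comp, ← rep_spec f, CosetCat.toFun_coe, ← rep_spec g, MulAction.Quotient.smul_coe, smul_eq_mul]
  rw [M.coe_pull_eq_act (f ≫ g) hpt, map_mul, MulAut.mul_apply]
  rfl

/-- **`G/U ↦ Ψ^U` as a monoid on the base `CosetCat G`** (contravariant functor to commutative monoids; [FrdI]
Def 1.1 (ii) shape), the functor underlying the Frobenioids of [IUTchII] Def 3.8 (i)(ii).
[cite: Mochizuki2012, Def 3.8 (i) p.113] -/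
def invariantsFunctor : (CosetCat G)ᵒᵖ ⥤ CommMonCat.{v} where
  obj X := CommMonCat.of (M.invariants ((unop X).sg : Subgroup G))
  map f := CommMonCat.ofHom (M.pull f.unop)
  map_id X := by
    apply CommMonCat.hom_ext
    ext x
    rw [CommMonCat.hom_ofHom, CommMonCat.hom_id, MonoidHom.id_apply]
    exact congrArg Subtype.val (M.pull_id (unop X) x)
  map_comp f g := by
    apply CommMonCat.hom_ext
    ext x
    rw [CommMonCat.hom_ofHom, CommMonCat.hom_comp, CommMonCat.hom_ofHom, CommMonCat.hom_ofHom,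
      MonoidHom.comp_apply]
    exact congrArg Subtype.val (M.pull_comp g.unop f.unop x)

/-- The value of `invariantsFunctor` at `G/U` is `Ψ^U`. [cite: Mochizuki2012, Def 3.8 (i) p.113] -/
theorem invariantsFunctor_obj (X : (CosetCat G)ᵒᵖ) :
    M.invariantsFunctor.obj X = CommMonCat.of (M.invariants ((unop X).sg : Subgroup G)) := rfl

/-- The pull-back maps of `invariantsFunctor` are the `pull`s. [cite: Mochizuki2012, Def 3.8 (i) p.113] -/
theorem invariantsFunctor_map {X Y : (CosetCat G)ᵒᵖ} (f : X ⟶ Y) :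
    (M.invariantsFunctor.map f).hom = M.pull f.unop := rfl

/-! ### Divisor monoid, rational-function monoid, `Div_B`, and the model Frobenioid -/

/-- The class map `Φ ⟶ Φ^char` as a morphism of monoids on a category ([FrdI] §0 `M → M^char`, natural in `M`).
[cite: MochizukiFrdI2008, §0 p.11] -/
def toCharNatTrans {D : Type u₁} [Category.{v₁} D] (Φ : Dᵒᵖ ⥤ CommMonCat.{w}) : Φ ⟶ charFunctor Φ where
  app A := CommMonCat.ofHom (Associates.mkMonoidHom : Φ.obj A →* Associates (Φ.obj A))
  naturality A B f := by
    apply CommMonCat.hom_ext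
    ext x
    simp only [CommMonCat.hom_comp, MonoidHom.comp_apply]
    rfl

/-- `toCharNatTrans` at `A` is the class map `a ↦ [a]`. [cite: MochizukiFrdI2008, §0 p.11] -/
theorem toCharNatTrans_app_apply {D : Type u₁} [Category.{v₁} D] (Φ : Dᵒᵖ ⥤ CommMonCat.{w}) (A : Dᵒᵖ)
    (a : Φ.obj A) : ((toCharNatTrans Φ).app A).hom a = Associates.mk a := rfl

/-- **The divisor monoid** `Φ : G/U ↦ Ψ^U/(Ψ^U)^×` of the Frobenioid attached to `G ↷ Ψ` ([FrdII] Ex 1.1 (ii): the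
divisor monoid is the characteristic of the monoid; abc-iut-L1's `charFunctor` BY NAME).
[cite: Mochizuki2012, Def 3.8 (i) p.113] -/
abbrev divisorFunctor : (CosetCat G)ᵒᵖ ⥤ CommMonCat.{v} := charFunctor M.invariantsFunctor

/-- **The rational-function monoid** `B : G/U ↦ (Ψ^U)^gp` ([FrdII] Ex 1.1 (ii) `B`, monoid type `ℤ`; abc-iut-L1's
`monoidGp` BY NAME). [cite: Mochizuki2012, Def 3.8 (i) p.113] -/
abbrev ratFnFunctor : (CosetCat G)ᵒᵖ ⥤ CommMonCat.{v} := monoidGp M.invariantsFunctor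

/-- **`Div_B : B ⟶ Φ^gp`** — the groupified class map `(Ψ^U)^gp → (Ψ^U/(Ψ^U)^×)^gp`.
[cite: Mochizuki2012, Def 3.8 (i) p.113] -/
def divB : M.ratFnFunctor ⟶ monoidGp M.divisorFunctor :=
  Functor.whiskerRight (toCharNatTrans M.invariantsFunctor) MonGp.functor

/-- **The Frobenioid attached to the `G`-monoid `G ↷ Ψ`** ([IUTchII] Def 3.8 (i) `F_cns(M^Θ_*)`, `F_{†C_v}`;
(ii) `F^ι_env(M^Θ_*)`, `F_{†F^Θ_v,α}`, `F_ξ(M^Θ_*)`, `F_{F_ξ}(†F_v)` — «gives rise to a `p_v`-adic Frobenioid of monoid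
type `ℤ` [cf. [FrdII], Example 1.1, (ii)]»): abc-iut-L1-t2's model Frobenioid ([FrdI] Thm 5.2 (i)) of
`(Φ, B, Div_B)` over `CosetCat G`. [cite: Mochizuki2012, Def 3.8 (ii) p.113] -/
abbrev frobenioid : Type (max u v) := ModelFrobenioid M.divisorFunctor M.ratFnFunctor M.divB

/-! ### `G`-monoids cut out of an ambient action by a stable submonoid -/

omit [TopologicalSpace G] in
/-- The action `ρ : G → Aut(H)` restricted to a `ρ`-stable submonoid `S ⊆ H`.
[cite: Mochizuki2012, Def 3.8 (ii) p.113] -/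
def restrictAct {H : Type v} [CommGroup H] (ρ : G →* MulAut H) (S : Submonoid H)
    (hS : ∀ (g : G) (x : H), x ∈ S → ρ g x ∈ S) : G →* MulAut S where
  toFun g :=
    { toFun := fun x => ⟨ρ g x.1, hS g x.1 x.2⟩
      invFun := fun x => ⟨ρ g⁻¹ x.1, hS g⁻¹ x.1 x.2⟩
      left_inv := fun x => Subtype.ext (by
        change ρ g⁻¹ (ρ g x.1) = x.1
        rw [← MulAut.mul_apply, ← map_mul, inv_mul_cancel, map_one, MulAut.one_apply])
      right_inv := fun x => Subtype.ext (by
        change ρ g (ρ g⁻¹ x.1) = x.1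
        rw [← MulAut.mul_apply, ← map_mul, mul_inv_cancel, map_one, MulAut.one_apply])
      map_mul' := fun x y => Subtype.ext (map_mul (ρ g) x.1 y.1) }
  map_one' := by
    ext x
    change ρ 1 (x : H) = (x : H)
    rw [map_one, MulAut.one_apply]
  map_mul' g g' := by
    ext x
    change ρ (g * g') (x : H) = ρ g (ρ g' (x : H))
    rw [map_mul, MulAut.mul_apply]

omit [TopologicalSpace G] in
/-- `restrictAct` is `ρ` on underlying elements. [cite: Mochizuki2012, Def 3.8 (ii) p.113] -/
theorem coe_restrictAct_apply {H : Type v} [CommGroup H] (ρ : G →* MulAut H) (S : Submonoid H)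
    (hS : ∀ (g : G) (x : H), x ∈ S → ρ g x ∈ S) (g : G) (x : S) :
    ((restrictAct ρ S hS g x : S) : H) = ρ g (x : H) := rfl

omit [TopologicalSpace G] in
/-- A `ρ`-stable submonoid `S` of a commutative group `H` with `G`-action `ρ` is a `G`-monoid (this is how
`Ψ^ι_env(M^Θ_*) = M^×_TM·θ^ℕ ⊆ lim_J H¹(…)`, `Ψ_{†F^Θ_v,α} ⊆ O^×(T^÷_{A^Θ_∞})`, `Ψ_ξ`, `Ψ_{F_ξ}`, `Ψ_cns` of [IUTchII] §3
carry their actions). [cite: Mochizuki2012, Def 3.8 (ii) p.113] -/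
abbrev ofStable {H : Type v} [CommGroup H] (ρ : G →* MulAut H) (S : Submonoid H)
    (hS : ∀ (g : G) (x : H), x ∈ S → ρ g x ∈ S) : CoveringMonoid.{u, v} G :=
  { O := S, act := restrictAct ρ S hS }

omit [TopologicalSpace G] in
/-- Invariants of `ofStable ρ S hS` under `U`: the elements of `S` fixed by `ρ(U)`.
[cite: Mochizuki2012, Def 3.8 (ii) p.113] -/
theorem mem_invariants_ofStable_iff {H : Type v} [CommGroup H] (ρ : G →* MulAut H) (S : Submonoid H)
    (hS : ∀ (g : G) (x : H), x ∈ S → ρ g x ∈ S) (U : Subgroup G) (x : S) :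
    x ∈ (ofStable ρ S hS).invariants U ↔ ∀ u ∈ U, ρ u (x : H) = (x : H) := by
  rw [mem_invariants_iff]
  refine forall₂_congr fun u _ => ?_
  exact ⟨fun h => congrArg Subtype.val h, fun h => Subtype.ext h⟩

end CoveringMonoid

end Literature.IUT.HodgeArakelov

end
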